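import Literature.AnabelianGeometry.AbsoluteAnabelian.AbsAnabProp121viiUnrCharTransportProofs
import HarnessLib

/-!
# [AbsAnab] Prop 1.2.1 (vii), sub-DAG row L09a `TransportedCocycleNormalized`: the normalised unramified
# cocycle of `K₁`, transported along `(α, ψ̄|μ_n)`, is a normalised unramified cocycle of `K₂` — PROOF

S. Mochizuki, *The Absolute Anabelian Geometry of Hyperbolic Curves* (2004) [AbsAnab], §1.2,
Prop 1.2.1 (vii) p. 11 and its proof p. 11 – p. 12 l. 1 (lit key paper:url-e8f118cc205e): the
identification `H²(Gal(K^unr/K), (K^unr)^×) ⥲ H²(Ẑ, ℤ) = ℚ/ℤ` is "group-theoretic, by (ii), (iii), (iv)"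
— at finite level `n` the datum carried along `α` is the normalised unramified character
`χ : G_K ↠ Gal(K^unr/K) ≅ Ẑ → ℤ/n`, `Frob ↦ 1`, i.e. the crossed homomorphism `σ ↦ χ(σ)·id ∈ μ_n^∨(1)`
[cite: MochizukiAbsAnab2004, Prop 1.2.1 (vii) p.11].

PROOF-ONLY companion (abc-iut cell, layer L4; sub-DAG `plan/L4/SUBDAG-AbsAnab-Prop121vii.md`, row
`AbsAnab:Prop1.2.1(vii)/L09a`, opened by the sub-DAG holder abc-iut-w5-d198 for this seat (abc-iut-w5-d214)
and consumed as hypothesis `(hg₂)` of the assembly `Prop121vii.statement_of` (p416012); statements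
`AbsAnabProp121viiSub.lean`, p414342).  PROVED, in EXACTLY the requested `∃`-shape:
**`Prop121vii.exists_transportedCocycle`** — for `α : G_{K₁} ≃ₜ* G_{K₂}` (characteristic-`0`
non-archimedean local fields, universe `0`), an `α`-equivariant `ψ̄ : K̄₁^× ⥲ K̄₂^×` and a normalised
unramified cocycle `g₁ : G_{K₁} → Hom(μ_n(K̄₁), μ_n(K̄₁))` of `K₁`, there is a normalised unramified cocycle
`g₂` of `K₂` with `g₂(α σ)(ψ̄ m) = ψ̄(g₁(σ)(m))` (the hypothesis shape of row L01a `CohTransportCup`,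
abc-iut-w5-d232, p415439).  WITNESS: `g₂(σ₂) := ψ̄|μ_n ∘ g₁(α⁻¹σ₂) ∘ (ψ̄|μ_n)⁻¹` (continuous: `G_{K₂} → G_{K₁} →
Hom(μ_n, μ_n)` with discrete target; a crossed homomorphism because conjugation by the `α`-equivariant
`ψ̄|μ_n` is `α`-equivariant for the Tate-dual actions); its character is `χ₁ ∘ α⁻¹`, which kills `I_{K₂}`
and is `1` on the arithmetic-Frobenius lifts of `K₂` by [AbsAnab] Prop 1.2.1 (ii)/(iv) in valued form
applied to `α⁻¹` (abc-iut-w5-d198's `map_absInertia_eq`, `isFrobPow_one_map`, p415378 — "group-theoretic,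
by (ii), (iv)"; no additivity of `χ₁` is needed).  Helper identities: `muCarrierMap_symm_apply_apply`,
`muCarrierMap_apply_symm_apply`, `isAlphaEquivariant_symm`.  No definitions; classical, undisputed
material; nothing here bears on [IUTchIII] Cor. 3.12; no new named prerequisite.
-/

noncomputable section

namespace Literature.AnabelianGeometry.AbsoluteAnabelian

open Field CategoryTheory ValuativeRel ContRepresentation
open Literature.NumberTheory.GaloisRepresentations
open Literature.NumberTheory.GaloisRepresentations.DiscreteGaloisModule

namespace Prop121vii

universe u

section Coefficients

variable {K₁ K₂ : Type u} [Field K₁] [Field K₂]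

/-- `(ψ̄|μ_n)⁻¹ ∘ (ψ̄|μ_n) = id` on the additive carrier of `μ_n(K̄₁)`.
[cite: MochizukiAbsAnab2004, Prop 1.2.1 (vi) p.10] -/
theorem muCarrierMap_symm_apply_apply (ψ : (AlgebraicClosure K₁)ˣ ≃* (AlgebraicClosure K₂)ˣ) (n : ℕ)
    (m : MuCarrier K₁ n) :
    muCarrierMap ψ.symm.toMonoidHom n (muCarrierMap ψ.toMonoidHom n m) = m := by
  apply (MuCarrier.toAdditive (K := K₁) (n := n)).injective
  apply Additive.toMul.injective
  apply Subtype.ext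
  change ψ.symm (ψ ((Additive.toMul (MuCarrier.toAdditive m) :
      rootsOfUnity n (AlgebraicClosure K₁)) : (AlgebraicClosure K₁)ˣ)) =
    ((Additive.toMul (MuCarrier.toAdditive m) : rootsOfUnity n (AlgebraicClosure K₁)) :
      (AlgebraicClosure K₁)ˣ)
  exact ψ.symm_apply_apply _

/-- `(ψ̄|μ_n) ∘ (ψ̄|μ_n)⁻¹ = id` on the additive carrier of `μ_n(K̄₂)`.
[cite: MochizukiAbsAnab2004, Prop 1.2.1 (vi) p.10] -/
theorem muCarrierMap_apply_symm_apply (ψ : (AlgebraicClosure K₁)ˣ ≃* (AlgebraicClosure K₂)ˣ) (n : ℕ)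
    (m : MuCarrier K₂ n) :
    muCarrierMap ψ.toMonoidHom n (muCarrierMap ψ.symm.toMonoidHom n m) = m :=
  muCarrierMap_symm_apply_apply ψ.symm n m

/-- If `ψ̄` is `α`-equivariant then `ψ̄⁻¹` is `α⁻¹`-equivariant. [cite: MochizukiAbsAnab2004, Prop 1.2.1 (vi) p.10] -/
theorem isAlphaEquivariant_symm {α : absoluteGaloisGroup K₁ ≃ₜ* absoluteGaloisGroup K₂}
    {ψ : (AlgebraicClosure K₁)ˣ ≃* (AlgebraicClosure K₂)ˣ} (hψ : IsAlphaEquivariant α ψ) :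
    IsAlphaEquivariant α.symm ψ.symm := by
  intro τ y
  apply ψ.injective
  rw [ψ.apply_symm_apply, hψ, ContinuousMulEquiv.apply_symm_apply, ψ.apply_symm_apply]

/-- `ψ̄⁻¹((α σ)⁻¹ · m) = σ⁻¹ · ψ̄⁻¹(m)` on `μ_n` for an `α`-equivariant `ψ̄`.
[cite: MochizukiAbsAnab2004, Prop 1.2.1 (vi) p.10] -/
theorem muCarrierMap_symm_inv_smul {α : absoluteGaloisGroup K₁ ≃ₜ* absoluteGaloisGroup K₂}
    {ψ : (AlgebraicClosure K₁)ˣ ≃* (AlgebraicClosure K₂)ˣ} (hψ : IsAlphaEquivariant α ψ) (n : ℕ)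
    (σ : absoluteGaloisGroup K₁) (m : MuCarrier K₂ n) :
    muCarrierMap ψ.symm.toMonoidHom n (mu K₂ n (α σ)⁻¹ m) =
      mu K₁ n σ⁻¹ (muCarrierMap ψ.symm.toMonoidHom n m) := by
  have h := isEquivariantOver_muCarrierMap (isAlphaEquivariant_symm hψ) n (α σ)⁻¹ m
  have e : α.symm (α σ)⁻¹ = σ⁻¹ := by
    rw [map_inv, ContinuousMulEquiv.symm_apply_apply]
  rw [e] at h
  exact h

end Coefficients

section Transported

variable {K₁ K₂ : Type} [Field K₁] [ValuativeRel K₁] [TopologicalSpace K₁] [IsNonarchimedeanLocalField K₁]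
  [CharZero K₁] [Field K₂] [ValuativeRel K₂] [TopologicalSpace K₂] [IsNonarchimedeanLocalField K₂]
  [CharZero K₂]

/-- **Row L09a `TransportedCocycleNormalized`, PROVED** (in the `∃`-shape consumed by the assembly
`Prop121vii.statement_of`, hypothesis `hg₂`): for an `α`-equivariant `ψ̄` and every normalised unramified
cocycle `g₁` of `K₁` there is a normalised unramified cocycle `g₂` of `K₂` corresponding to `g₁` under `α`
and conjugation by `ψ̄|μ_n`, `g₂(α σ)(ψ̄ m) = ψ̄(g₁(σ)(m))`.  Witness `g₂(σ₂) := ψ̄|μ_n ∘ g₁(α⁻¹σ₂) ∘ (ψ̄|μ_n)⁻¹`,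
character `χ₁ ∘ α⁻¹` ([AbsAnab] (ii)/(iv) for `α⁻¹`: "group-theoretic, by (ii), (iv)", p. 12 l. 1).
[cite: MochizukiAbsAnab2004, Prop 1.2.1 (vii) p.11] -/
theorem exists_transportedCocycle (α : absoluteGaloisGroup K₁ ≃ₜ* absoluteGaloisGroup K₂)
    (ψ : (AlgebraicClosure K₁)ˣ ≃* (AlgebraicClosure K₂)ˣ) (n : ℕ)
    [Finite (MuCarrier K₁ n)] [Finite (MuCarrier K₂ n)] :
    IsAlphaEquivariant α ψ →
      ∀ g₁ : contOneCocycles ((mu K₁ n).tateDual n).toTopRep, IsNormalizedUnramifiedCocycle K₁ n g₁ →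
        ∃ g₂ : contOneCocycles ((mu K₂ n).tateDual n).toTopRep,
          IsNormalizedUnramifiedCocycle K₂ n g₂ ∧
            ∀ (σ : absoluteGaloisGroup K₁) (m : MuCarrier K₁ n),
              g₂.1 (α σ) (muCarrierMap ψ.toMonoidHom n m) =
                MuCarrier.toAdditive
                  (muCarrierMap ψ.toMonoidHom n (MuCarrier.toAdditive.symm (g₁.1 σ m))) := by
  intro hψ g₁ hg₁
  -- conjugation by `ψ̄|μ_n` on the Tate duals: `F ↦ ψ̄ ∘ F ∘ ψ̄⁻¹`
  let e : MuCarrier K₁ n →+ MuCarrier K₂ n := muCarrierMap ψ.toMonoidHom n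
  let e' : MuCarrier K₂ n →+ MuCarrier K₁ n := muCarrierMap ψ.symm.toMonoidHom n
  let conj : TateDual K₁ (MuCarrier K₁ n) n →+ TateDual K₂ (MuCarrier K₂ n) n :=
    { toFun := fun F =>
        show MuCarrier K₂ n →+ Additive (rootsOfUnity n (AlgebraicClosure K₂)) from
          ((MuCarrier.toAdditive (K := K₂) (n := n)).toAddMonoidHom.comp e).comp
            (((MuCarrier.toAdditive (K := K₁) (n := n)).symm.toAddMonoidHom.comp
              (show MuCarrier K₁ n →+ Additive (rootsOfUnity n (AlgebraicClosure K₁)) from F)).comp e')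
      map_zero' := by
        refine TateDual.ext fun m => ?_
        change MuCarrier.toAdditive (e (MuCarrier.toAdditive.symm
          ((0 : TateDual K₁ (MuCarrier K₁ n) n) (e' m)))) = (0 : TateDual K₂ (MuCarrier K₂ n) n) m
        rw [show (0 : TateDual K₁ (MuCarrier K₁ n) n) (e' m) = 0 from rfl,
          show (0 : TateDual K₂ (MuCarrier K₂ n) n) m = 0 from rfl, map_zero, map_zero, map_zero]
      map_add' := fun F G => by
        refine TateDual.ext fun m => ?_
        change MuCarrier.toAdditive (e (MuCarrier.toAdditive.symm ((F + G) (e' m)))) =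
          MuCarrier.toAdditive (e (MuCarrier.toAdditive.symm (F (e' m)))) +
            MuCarrier.toAdditive (e (MuCarrier.toAdditive.symm (G (e' m))))
        rw [show (F + G) (e' m) = F (e' m) + G (e' m) from rfl, map_add, map_add, map_add] }
  have conj_apply : ∀ (F : TateDual K₁ (MuCarrier K₁ n) n) (m : MuCarrier K₂ n),
      conj F m = MuCarrier.toAdditive (e (MuCarrier.toAdditive.symm (F (e' m)))) := fun _ _ => rfl
  -- `conj` is `α`-equivariant for the Tate-dual actions `(σ·F)(m) = σ(F(σ⁻¹ m))`
  have hequiv : ∀ (σ : absoluteGaloisGroup K₁) (F : TateDual K₁ (MuCarrier K₁ n) n),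
      conj ((mu K₁ n).tateDual n σ F) = (mu K₂ n).tateDual n (α σ) (conj F) := by
    intro σ F
    refine TateDual.ext fun m => ?_
    rw [conj_apply, tateDual_apply_apply_apply, tateDual_apply_apply_apply, conj_apply,
      muCarrierMap_symm_inv_smul hψ n σ m]
    exact congrArg MuCarrier.toAdditive (isEquivariantOver_muCarrierMap hψ n σ
      (MuCarrier.toAdditive.symm (F (mu K₁ n σ⁻¹ (e' m)))))
  -- the witness `g₂ := conj ∘ g₁ ∘ α⁻¹`
  let g₂ : contOneCocycles ((mu K₂ n).tateDual n).toTopRep :=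
    ⟨⟨fun σ₂ => conj (g₁.1 (α.symm σ₂)),
        (continuous_of_discreteTopology (f := conj)).comp (g₁.1.continuous.comp α.symm.continuous)⟩,
      fun σ τ => by
        change conj (g₁.1 (α.symm (σ * τ))) =
          conj (g₁.1 (α.symm σ)) + ((mu K₂ n).tateDual n).toTopRep.ρ σ (conj (g₁.1 (α.symm τ)))
        rw [map_mul, g₁.2 (α.symm σ) (α.symm τ), map_add, ContinuousRep.toTopRep_ρ_apply,
          ContinuousRep.toTopRep_ρ_apply, hequiv, ContinuousMulEquiv.apply_symm_apply]⟩
  have g₂_apply : ∀ (σ₂ : absoluteGaloisGroup K₂) (m : MuCarrier K₂ n),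
      g₂.1 σ₂ m = MuCarrier.toAdditive (e (MuCarrier.toAdditive.symm (g₁.1 (α.symm σ₂) (e' m)))) :=
    fun _ _ => rfl
  obtain ⟨χ, hχ, hI, hF⟩ := hg₁
  refine ⟨g₂, ⟨fun σ₂ => χ (α.symm σ₂), fun σ₂ m => ?_, fun σ₂ hσ₂ => hI _ ?_, fun σ₂ hσ₂ => hF _ ?_⟩,
    fun σ m => ?_⟩
  · -- `g₂(σ₂)(m) = χ(α⁻¹σ₂) · m`
    rw [g₂_apply, hχ, map_zsmul, map_zsmul, map_zsmul, AddEquiv.symm_apply_apply]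
    exact congrArg _ (congrArg MuCarrier.toAdditive (muCarrierMap_apply_symm_apply ψ n m))
  · -- `α⁻¹ σ₂ ∈ I_{K₁}`, by (ii) for `α⁻¹`
    have h := Subgroup.mem_map_of_mem α.symm.toMulEquiv.toMonoidHom hσ₂
    rw [map_absInertia_eq α.symm] at h
    exact h
  · -- `α⁻¹ σ₂` is an arithmetic-Frobenius lift, by (iv) for `α⁻¹`
    exact isFrobPow_one_map α.symm hσ₂
  · -- the correspondence with `g₁`
    rw [g₂_apply, ContinuousMulEquiv.symm_apply_apply]
    exact congrArg MuCarrier.toAdditive (congrArg e (congrArg _ (congrArg _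
      (muCarrierMap_symm_apply_apply ψ n m))))

end Transported

end Prop121vii

end Literature.AnabelianGeometry.AbsoluteAnabelian

end
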